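import Summits.ResolutionOfSingularities.ResolutionOfSingularities.Theorems.EquisingularLiftEquisingularLiftNatVertexLineChartA
import HarnessLib

/-!
# [OURS · L1 W4.5(b) · EL♮(3) · nose residue, D3-9 / Steiner (H-ν2) clause `Z.Infinite`] The strict transform of a line through the blown-up
# vertex is an INFINITE set (over an infinite field)

Crux chain w45b, child EL♮(3) = stmt-ResolutionOfSingularities-20148; the `Z.Infinite` clause of `ReachPtNoseBTriplePrime` (…NatResidueHypDefs5) for the
Steiner nose (NOSE WORD v1.4 §3 row 1 (a)). res-L1-w45b-nose-w3 g2. `--supports stmt-ResolutionOfSingularities-20148 --as helper`. OURS; folklore;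
AI-written. No `sorry`; standard axioms; DEF-FREE (de Jong kit's `attribute [local instance] MvPolynomial.gradedAlgebra`).

* `evalLineHom i₀ a : Cᵢ₀ →+* k` — NOT a def: written inline as `eval (· ↦ a) ∘ map constantCoeff ∘ polyEquiv⁻¹` («the point `Y = 0`, `T = a` of the line
  on the vertex chart»); `ker` is a prime containing `𝔮 = (X_j/X_{i₀} : j ≠ i₀)` and `X_{i₀} − a` (`span_frac_le_ker_eval`, `exc_sub_mem_ker_eval`), and
  `a ↦ ker` is injective (`ker_eval_injective`).
* ★ `infinite_vertexLineStrict` — `[Infinite k]` ⇒ `(vertexLineStrict b i₀).Infinite`: the vertex chart embeds the infinitely many points `T = a` of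
  `V(𝔮)` (✓ `preimage_vertexChart_vertexLineStrict`) injectively into the strict transform.

References (index only): R. Hartshorne (1977), I Ex. 1.1 / II §7 [cite: Hartshorne1977].
-/

set_option linter.dupNamespace false -- mandated namespace `Summit.<Summit>.<Problem>` of this single-conjunct summit

noncomputable section

open CategoryTheory AlgebraicGeometry TopologicalSpace
open Literature.AlgebraicGeometry.Resolution Literature.AlgebraicGeometry.Resolution.DeJong1996
open Literature.AlgebraicGeometry.Resolution.PointBlowup (Chart Base frac exc polyEquiv polyHom baseHom)
open Literature.AlgebraicGeometry.Motives.Segre (grading X_mem)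

attribute [local instance] MvPolynomial.gradedAlgebra

namespace Summit.ResolutionOfSingularities.ResolutionOfSingularities.Cruxes.EquisingularLiftNat.Sections

section Algebra

variable {d : ℕ} {k : Type} [Field k] (i₀ : Fin (d + 1))

/-- The evaluation `Cᵢ₀ ≅ k[Y][T] → k`, `Y ↦ 0`, `T ↦ a`, kills the `X_j/X_{i₀}`. [folklore] -/
theorem span_frac_le_ker_eval (a : k) :
    Ideal.span (frac d k i₀ '' {i₀}ᶜ) ≤ RingHom.ker (((MvPolynomial.eval fun _ : Unit => a).comp
      (MvPolynomial.map (σ := Unit) (MvPolynomial.constantCoeff : Base d k i₀ →+* k))).comp (polyEquiv d k i₀).symm.toRingHom) := by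
  rw [Ideal.span_le]
  rintro _ ⟨j, hj, rfl⟩
  rw [SetLike.mem_coe, RingHom.mem_ker, RingHom.comp_apply, RingHom.comp_apply, RingEquiv.toRingHom_eq_coe, RingEquiv.coe_toRingHom,
    polyEquiv_symm_frac i₀ hj, MvPolynomial.map_C, MvPolynomial.constantCoeff_X, MvPolynomial.C_0, map_zero]

/-- It sends `X_{i₀}` to `a` and the constant `a'` to `a'`; hence `X_{i₀} − a` lies in its kernel. [folklore] -/
theorem exc_sub_mem_ker_eval (a : k) :
    exc d k i₀ - algebraMap k (Chart d k i₀) a ∈ RingHom.ker (((MvPolynomial.eval fun _ : Unit => a).comp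
      (MvPolynomial.map (σ := Unit) (MvPolynomial.constantCoeff : Base d k i₀ →+* k))).comp (polyEquiv d k i₀).symm.toRingHom) := by
  rw [RingHom.mem_ker, map_sub, RingHom.comp_apply, RingHom.comp_apply, RingEquiv.toRingHom_eq_coe, RingEquiv.coe_toRingHom,
    polyEquiv_symm_exc, MvPolynomial.map_X, MvPolynomial.eval_X, RingHom.comp_apply, RingHom.comp_apply, RingEquiv.coe_toRingHom]
  have h : (polyEquiv d k i₀).symm (algebraMap k (Chart d k i₀) a) = MvPolynomial.C (MvPolynomial.C a) := by
    apply (polyEquiv d k i₀).injective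
    rw [RingEquiv.apply_symm_apply, PointBlowup.polyEquiv_apply, PointBlowup.polyHom_C, PointBlowup.baseHom_C]
  rw [h, MvPolynomial.map_C, MvPolynomial.constantCoeff_C, MvPolynomial.eval_C, sub_self]

/-- The evaluation restricted to constants is the identity: `a' ↦ a'`. [folklore] -/
theorem eval_algebraMap (a a' : k) :
    (((MvPolynomial.eval fun _ : Unit => a).comp (MvPolynomial.map (σ := Unit) (MvPolynomial.constantCoeff : Base d k i₀ →+* k))).comp
      (polyEquiv d k i₀).symm.toRingHom) (algebraMap k (Chart d k i₀) a') = a' := by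
  rw [RingHom.comp_apply, RingHom.comp_apply, RingEquiv.toRingHom_eq_coe, RingEquiv.coe_toRingHom]
  have h : (polyEquiv d k i₀).symm (algebraMap k (Chart d k i₀) a') = MvPolynomial.C (MvPolynomial.C a') := by
    apply (polyEquiv d k i₀).injective
    rw [RingEquiv.apply_symm_apply, PointBlowup.polyEquiv_apply, PointBlowup.polyHom_C, PointBlowup.baseHom_C]
  rw [h, MvPolynomial.map_C, MvPolynomial.constantCoeff_C, MvPolynomial.eval_C]

/-- **The points `T = a` are pairwise distinct**: `a ↦ ker(eval_a)` is injective. [folklore] -/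
theorem ker_eval_injective :
    Function.Injective fun a : k => RingHom.ker (((MvPolynomial.eval fun _ : Unit => a).comp
      (MvPolynomial.map (σ := Unit) (MvPolynomial.constantCoeff : Base d k i₀ →+* k))).comp (polyEquiv d k i₀).symm.toRingHom) := by
  intro a a' h
  have ha' : exc d k i₀ - algebraMap k (Chart d k i₀) a' ∈ RingHom.ker (((MvPolynomial.eval fun _ : Unit => a).comp
      (MvPolynomial.map (σ := Unit) (MvPolynomial.constantCoeff : Base d k i₀ →+* k))).comp (polyEquiv d k i₀).symm.toRingHom) := by
    have := exc_sub_mem_ker_eval i₀ a'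
    change _ ∈ (fun a : k => RingHom.ker _) a' at this
    rwa [← h] at this
  have hdiff := Ideal.sub_mem _ ha' (exc_sub_mem_ker_eval i₀ a)
  rw [sub_sub_sub_cancel_left, ← map_sub, RingHom.mem_ker, eval_algebraMap] at hdiff
  exact sub_eq_zero.mp hdiff

end Algebra

section Infinite

variable {d : ℕ} {k : Type} [Field k] {P : Scheme.{0}} {b : P ⟶ Proj (grading (Fin (d + 1 + 1)) k)}
  (hb : IsBlowup b (vertexIdealSheaf d k)) (i₀ : Fin (d + 1))

include hb in
/-- ★ **The strict transform of a line through the blown-up vertex is infinite** (over an infinite field): the vertex chart embeds the points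
`Y = 0, T = a`, `a ∈ k`, of `V(X_j/X_{i₀} : j ≠ i₀)` injectively into it. [cite: Hartshorne1977, II §7] (OURS computation; folklore) -/
theorem infinite_vertexLineStrict [Infinite k] : (vertexLineStrict b i₀).Infinite := by
  -- the points `T = a` of the vertex chart
  let pt : k → Spec (.of (Chart d k i₀)) := fun a =>
    ⟨RingHom.ker (((MvPolynomial.eval fun _ : Unit => a).comp
      (MvPolynomial.map (σ := Unit) (MvPolynomial.constantCoeff : Base d k i₀ →+* k))).comp (polyEquiv d k i₀).symm.toRingHom),
      RingHom.ker_isPrime _⟩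
  have hpt : Function.Injective pt := fun a a' h => ker_eval_injective i₀ (congrArg (fun p : Spec (.of (Chart d k i₀)) => p.asIdeal) h)
  have hmem : ∀ a, vertexChart hb i₀ (pt a) ∈ vertexLineStrict b i₀ := fun a => by
    change pt a ∈ (vertexChart hb i₀) ⁻¹' vertexLineStrict b i₀
    rw [preimage_vertexChart_vertexLineStrict hb i₀]
    exact span_frac_le_ker_eval i₀ a
  have hinj : Function.Injective fun a => vertexChart hb i₀ (pt a) :=
    (vertexChart hb i₀).isOpenEmbedding.injective.comp hpt
  exact Set.infinite_of_injective_forall_mem hinj hmem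

end Infinite

end Summit.ResolutionOfSingularities.ResolutionOfSingularities.Cruxes.EquisingularLiftNat.Sections

end
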